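import Summits.BirchSwinnertonDyer.BirchSwinnertonDyer.Theorems.ThetaPartnerAtTwoSignedMainConjectureCMTwoRankZeroPTDeepAdmissible
import Summits.BirchSwinnertonDyer.BirchSwinnertonDyer.Theorems.ThetaPartnerAtTwoSignedMainConjectureCMTwoRankZeroPTDeepPairingCompat
import Summits.BirchSwinnertonDyer.BirchSwinnertonDyer.Theorems.ThetaPartnerAtTwoSignedKatoUpToAtTwoPointsLocalCover
import Literature.NumberTheory.DiophantineGeometry.LocalReductionFiniteBadPlacesProofs
import HarnessLib

/-!
# Route `ThetaPartnerAtTwo` (TP2), crux K2R0P♭ `SignedMainConjectureCMTwoRankZeroOfPubOfFlat` (stmt-BirchSwinnertonDyer-26471;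
# derived node K2r0P stmt-BirchSwinnertonDyer-24945), line `rankzero` v20 — the registered stub `stub_poitouTateDeepTwo` ((S_PT), habitat form)
# CLOSED MODULO EXACTLY TWO INPUTS: (E) levelwise Poitou–Tate existence in the admissible sets, (I)_bad the uniform inertia bound at the bad
# odd places — every other hypothesis of the assembly `poitouTateDeep_of_levelwise` is discharged here ((R): `…PTDeepAdmissible`, (C):
# `…PTDeepPairingCompat`, (I) outside `S`: `resLe_inertia_eq_zero_of_forall_reduceH1Pk`, finiteness of `S = {2} ∪ bad places`)

HONEST FRAMING (cell `pub/bsd-wall`, W-ALL row 1; lead prover `bsd-wall-tp2-p2` g10, `--supports` only). THEOREMS ONLY; CONDITIONAL on the two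
displayed hypotheses `hE` ((E) = bricks B1/B3/B4/B5/B6b, seats w2/w3/w4) and `hI` ((I)_bad = brick B6c, seat w5), whose TYPES this file pins
byte-for-byte; closes no item; BSD is NOT proved by any of this.

`poitouTateDeepTwo_of_levelwise_of_badInertia hE hI : <signature of stub_poitouTateDeepTwo VERBATIM>` with
* `hE` : for every `v ∋ 2`, CM class member `A`, cyclotomic `κ`, `γ`, THE pairing `pair` ((P3)): `∃ m₀, ∀ z` with H(z) (VERBATIM from the stub),
  `∀ n k, ∃ c ∈ H¹(Γ_n, A[2^k])` UNRAMIFIED OUTSIDE `S_A = {w ∋ 2} ∪ A.badPlaces` (restriction to `Γ_n ⊓ I_𝔓` vanishes, `𝔓 ∣ w ∉ S_A`) with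
  `⟨c, Q⟩_{n,2^k} = 2^{m₀} z(Q) mod 2^k` for all `Q ∈ E⁺(ℚ_n·ℚ_v)`;
* `hI` : for every CM class member `A` and cyclotomic `κ`: `∃ e, ∀ n, ∀ x ∈ H¹(Γ_n, T₂A)`, `2^e x` dies on `Γ_n ⊓ I_𝔓` for every `𝔓` over a bad
  place `w ∌ 2` (CM ⇒ additive potentially good ⇒ `(T₂A)^{I_𝔓} = 0` and `I_𝔓` acts through a finite quotient, uniformly in `n`).
Then `m := m₀ + e`.

References: [Kobayashi2003] (7.17)–(7.20), Thm. 7.3 (ii); [MilneADT2006] I Thm. 4.10; [Rubin2000] App. B Prop. B.2.3, §B.3; [Kato2004Asterisque] §8.2,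
§12.2; [SilvermanAEC2009] X.4.3, VIII.1 Remark 1.3.
-/

set_option autoImplicit false
-- the Theorems namespace of this sub repeats the summit name by design (D-0017 nested layout)
set_option linter.dupNamespace false

noncomputable section

open scoped Classical

namespace Summit.BirchSwinnertonDyer.BirchSwinnertonDyer.Theorems

namespace SignedLowerOffTwo.PTDeep

open CategoryTheory NumberField IsDedekindDomain Field WeierstrassCurve
  Literature.NumberTheory.EllipticCurves Literature.NumberTheory.EllipticCurves.Kobayashi2003
  Literature.NumberTheory.EllipticCurves.Sprung2012 Literature.NumberTheory.GaloisRepresentations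
  Literature.NumberTheory.EllipticCurves.Rank1Residual
  Literature.NumberTheory.EllipticCurves.Kato2004 Literature.NumberTheory.EllipticCurves.Kato2004.EulerSystemValues ZpExtension
  Rat.HeightOneSpectrum Summit.BirchSwinnertonDyer.Rank1Residual.Supersingular

/-- **`stub_poitouTateDeepTwo` ((S_PT), habitat form) modulo (E) and (I)_bad.**  See the module docstring; `hE` and `hI` are the two remaining
bricks of the kernel route, all other hypotheses of `poitouTateDeep_of_levelwise` being discharged by `…PTDeepAdmissible` ((R), (I) outside `S`),
`…PTDeepPairingCompat` ((C)) and the finiteness of `S_A = {w ∋ 2} ∪ A.badPlaces` (`WeierstrassCurve.finite_badPlaces_holds`).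
[cite: Kobayashi2003, (7.17)–(7.20) and Thm. 7.3 (ii) (pp. 12–13)] [cite: MilneADT2006, Ch. I Thm. 4.10] [cite: Rubin2000, App. B Prop. B.2.3 and §B.3]
[cite: SilvermanAEC2009, Lemma X.4.3 and VIII.1 Remark 1.3] -/
theorem poitouTateDeepTwo_of_levelwise_of_badInertia
    (hE : ∀ (v : HeightOneSpectrum (𝓞 ℚ)), ((2 : ℕ) : 𝓞 ℚ) ∈ v.asIdeal →
      ∀ (A : WeierstrassCurve ℚ) [A.IsElliptic] [A.IsGloballyMinimal],
        A.HasCM → A.analyticRank = 0 → GoodSS A 2 → A.frobeniusTrace 2 = 0 →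
        ∀ (κ : ZpExtension ℚ 2) (γ : Field.absoluteGaloisGroup ℚ),
          κ.IsCyclotomic → κ.IsTopGenerator γ →
        ∀ [ContinuousSMul ℤ_[2] (A.tateModule 2)]
          (pair : ∀ n : ℕ, H1 (tateRep A 2) (κ.layerSubgroup n) →ₗ[ℤ_[2]]
            (localLayerPointsOfEmb κ (closureEmb (K := ℚ) (v.adicCompletion ℚ)) A n →+ ℤ_[2])),
          (∀ (n k : ℕ) (x : H1 (tateRep A 2) (κ.layerSubgroup n))
            (Q : localLayerPointsOfEmb κ (closureEmb (K := ℚ) (v.adicCompletion ℚ)) A n),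
            PadicInt.toZModPow k (pair n x Q) = CyclotomicLayer.tatePairingPk A κ v n k x Q) →
        ∃ m₀ : ℕ,
          ∀ z : localTowerPointsOfEmb κ (closureEmb (K := ℚ) (v.adicCompletion ℚ)) A →+ ℤ_[2],
            (∀ (t : A.subgroupH1 2 κ.kerSubgroup), t ∈ signedSelmerInfty A κ 1 →
              ∀ (φ : contOneCocycles (discreteTopRep κ.kerSubgroup (A.geomPrimaryTorsion 2)))
                (Q : localPoints A (v.adicCompletion ℚ)) (k : ℕ), oneCocycleClass _ φ = t →
              ∀ hQ : 2 ^ k • Q ∈ (⨆ n, signedLocalPoints κ (v.adicCompletion ℚ) A 1 n),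
              (∀ τ : localSubgroupOfEmb κ.kerSubgroup (closureEmb (K := ℚ) (v.adicCompletion ℚ)),
                pointsMapOfEmb A (closureEmb (K := ℚ) (v.adicCompletion ℚ))
                    ((φ.1 (resGalSubgroupOfEmb κ.kerSubgroup _ τ) : A.geomPrimaryTorsion 2) : A.geomPoints) =
                  (τ : Field.absoluteGaloisGroup (v.adicCompletion ℚ)) • Q - Q) →
              (PadicInt.toZModPow k
                  (z ⟨2 ^ k • Q, SignedKatoOffTwo.KummerPoint.iSup_signedLocalPoints_le_localTowerPointsOfEmb A 2 κ 1 v hQ⟩)).val •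
                ((((2 : ℚ) ^ k)⁻¹ : ℚ) : AddCircle (1 : ℚ)) = 0) →
            ∀ n k : ℕ, ∃ c : A.torsionH1Over ((2 : ℤ) ^ k) (κ.layerSubgroup n),
              (∀ w : HeightOneSpectrum (𝓞 ℚ), w ∉ ({u : HeightOneSpectrum (𝓞 ℚ) | ((2 : ℕ) : 𝓞 ℚ) ∈ u.asIdeal} ∪ A.badPlaces (𝓞 ℚ)) →
                ∀ 𝔓 ∈ w.primesAbove,
                  resLe (A.torsionGaloisModule ((2 : ℤ) ^ k)).toTopRep
                    (inf_le_left : κ.layerSubgroup n ⊓ 𝔓.inertia (absoluteGaloisGroup ℚ) ≤ κ.layerSubgroup n) 1 c = 0) ∧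
              ∀ (Q : localPoints A (v.adicCompletion ℚ))
                (hQ : Q ∈ signedLocalPointsOfEmb κ (closureEmb (K := ℚ) (v.adicCompletion ℚ)) A 1 n),
                CyclotomicLayer.layerPairingMod A (2 ^ k) (CyclotomicLayer.weilTowerPk A k) (CyclotomicLayer.weilTowerPk_pow A k)
                    (CyclotomicLayer.weilTowerPk_add_left A k) (CyclotomicLayer.weilTowerPk_add_right A k)
                    (CyclotomicLayer.weilTowerPk_smul A k) κ v n c ⟨Q, signedLocalPointsOfEmb_le κ _ A 1 n hQ⟩ =
                  PadicInt.toZModPow k ((2 : ℤ_[2]) ^ m₀ *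
                    z ⟨Q, localLayerPointsOfEmb_le_localTowerPointsOfEmb κ _ A n (signedLocalPointsOfEmb_le κ _ A 1 n hQ)⟩))
    (hI : ∀ (A : WeierstrassCurve ℚ) [A.IsElliptic] [A.IsGloballyMinimal], A.HasCM →
      ∀ (κ : ZpExtension ℚ 2), κ.IsCyclotomic → ∀ [ContinuousSMul ℤ_[2] (A.tateModule 2)],
        ∃ e : ℕ, ∀ (n : ℕ) (x : H1 (tateRep A 2) (κ.layerSubgroup n)),
          ∀ w ∈ A.badPlaces (𝓞 ℚ), ((2 : ℕ) : 𝓞 ℚ) ∉ w.asIdeal → ∀ 𝔓 ∈ w.primesAbove,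
            resLe (tateRep A 2).toTopRep
              (inf_le_left : κ.layerSubgroup n ⊓ 𝔓.inertia (absoluteGaloisGroup ℚ) ≤ κ.layerSubgroup n) 1 (((2 : ℤ_[2]) ^ e) • x) = 0) :
    ∀ (v : HeightOneSpectrum (𝓞 ℚ)), ((2 : ℕ) : 𝓞 ℚ) ∈ v.asIdeal →
      ∀ (A : WeierstrassCurve ℚ) [A.IsElliptic] [A.IsGloballyMinimal],
        A.HasCM → A.analyticRank = 0 → GoodSS A 2 → A.frobeniusTrace 2 = 0 →
        ∀ (κ : ZpExtension ℚ 2) (γ : Field.absoluteGaloisGroup ℚ),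
          κ.IsCyclotomic → κ.IsTopGenerator γ →
        ∀ [ContinuousSMul ℤ_[2] (A.tateModule 2)] (I : Kato2004.IwasawaH1Data A 2 κ γ)
          (pair : ∀ n : ℕ, H1 (tateRep A 2) (κ.layerSubgroup n) →ₗ[ℤ_[2]]
            (localLayerPointsOfEmb κ (closureEmb (K := ℚ) (v.adicCompletion ℚ)) A n →+ ℤ_[2])),
          -- (P3) in Literature names: `pair` IS the `T₂A`-adic local Tate pairing
          (∀ (n k : ℕ) (x : H1 (tateRep A 2) (κ.layerSubgroup n))
            (Q : localLayerPointsOfEmb κ (closureEmb (K := ℚ) (v.adicCompletion ℚ)) A n),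
            PadicInt.toZModPow k (pair n x Q) = CyclotomicLayer.tatePairingPk A κ v n k x Q) →
        ∃ m : ℕ,
          (∀ z : localTowerPointsOfEmb κ (closureEmb (K := ℚ) (v.adicCompletion ℚ)) A →+ ℤ_[2],
            (∀ (t : A.subgroupH1 2 κ.kerSubgroup), t ∈ signedSelmerInfty A κ 1 →
              ∀ (φ : contOneCocycles (discreteTopRep κ.kerSubgroup (A.geomPrimaryTorsion 2)))
                (Q : localPoints A (v.adicCompletion ℚ)) (k : ℕ), oneCocycleClass _ φ = t →
              ∀ hQ : 2 ^ k • Q ∈ (⨆ n, signedLocalPoints κ (v.adicCompletion ℚ) A 1 n),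
              (∀ τ : localSubgroupOfEmb κ.kerSubgroup (closureEmb (K := ℚ) (v.adicCompletion ℚ)),
                pointsMapOfEmb A (closureEmb (K := ℚ) (v.adicCompletion ℚ))
                    ((φ.1 (resGalSubgroupOfEmb κ.kerSubgroup _ τ) : A.geomPrimaryTorsion 2) : A.geomPoints) =
                  (τ : Field.absoluteGaloisGroup (v.adicCompletion ℚ)) • Q - Q) →
              (PadicInt.toZModPow k
                  (z ⟨2 ^ k • Q, SignedKatoOffTwo.KummerPoint.iSup_signedLocalPoints_le_localTowerPointsOfEmb A 2 κ 1 v hQ⟩)).val •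
                ((((2 : ℚ) ^ k)⁻¹ : ℚ) : AddCircle (1 : ℚ)) = 0) →
            ∃ x : I.H, ∀ (n : ℕ) (Q : localPoints A (v.adicCompletion ℚ))
              (hQ : Q ∈ signedLocalPointsOfEmb κ (closureEmb (K := ℚ) (v.adicCompletion ℚ)) A 1 n),
              (2 : ℤ_[2]) ^ m *
                  z ⟨Q, localLayerPointsOfEmb_le_localTowerPointsOfEmb κ _ A n (signedLocalPointsOfEmb_le κ _ A 1 n hQ)⟩ =
                pair n (I.proj n x) ⟨Q, signedLocalPointsOfEmb_le κ _ A 1 n hQ⟩) := by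
  intro v hv A _ _ hcm hr hss ha κ γ hκ hγ _ I pair hP3
  obtain ⟨m₀, hm₀⟩ := hE v hv A hcm hr hss ha κ γ hκ hγ pair hP3
  obtain ⟨e, he⟩ := hI A hcm κ hκ
  refine ⟨m₀ + e, fun z hz ↦ ?_⟩
  -- the finite set `S_A = {w ∋ 2} ∪ bad places`
  have hSfin : ({u : HeightOneSpectrum (𝓞 ℚ) | ((2 : ℕ) : 𝓞 ℚ) ∈ u.asIdeal} ∪ A.badPlaces (𝓞 ℚ)).Finite := by
    refine Set.Finite.union ?_ (A.finite_badPlaces_holds (𝓞 ℚ))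
    have h2ne : ((2 : ℕ) : 𝓞 ℚ) ≠ 0 := by exact_mod_cast (two_ne_zero : (2 : ℕ) ≠ 0)
    have hne : Ideal.span {((2 : ℕ) : 𝓞 ℚ)} ≠ ⊥ := fun h ↦ h2ne (Ideal.span_singleton_eq_bot.mp h)
    refine (Ideal.finite_factors hne).subset fun w hw ↦ ?_
    simp only [Set.mem_setOf_eq] at hw ⊢
    exact Ideal.dvd_iff_le.mpr ((Ideal.span_singleton_le_iff_mem _).mpr hw)
  have hS2 : ∀ w : HeightOneSpectrum (𝓞 ℚ), ((2 : ℕ) : 𝓞 ℚ) ∈ w.asIdeal →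
      w ∈ ({u : HeightOneSpectrum (𝓞 ℚ) | ((2 : ℕ) : 𝓞 ℚ) ∈ u.asIdeal} ∪ A.badPlaces (𝓞 ℚ)) :=
    fun w hw ↦ Or.inl hw
  refine poitouTateDeep_of_levelwise A κ v I 1 pair hP3 z m₀ e
    (fun n k ↦ {c : A.torsionH1Over ((2 : ℤ) ^ k) (κ.layerSubgroup n) |
      ∀ w : HeightOneSpectrum (𝓞 ℚ), w ∉ ({u : HeightOneSpectrum (𝓞 ℚ) | ((2 : ℕ) : 𝓞 ℚ) ∈ u.asIdeal} ∪ A.badPlaces (𝓞 ℚ)) →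
        ∀ 𝔓 ∈ w.primesAbove,
          resLe (A.torsionGaloisModule ((2 : ℤ) ^ k)).toTopRep
            (inf_le_left : κ.layerSubgroup n ⊓ 𝔓.inertia (absoluteGaloisGroup ℚ) ≤ κ.layerSubgroup n) 1 c = 0})
    (fun n k ↦ admissible_finite A (pow_ne_zero k two_ne_zero) hSfin (κ.layerSubgroup n) (κ.isOpen_layerSubgroup n))
    (fun n k c hc ↦ admissible_reduceTorsionH1 A k (κ.layerSubgroup n) hc)
    (fun n k c hc ↦ admissible_layerCores A κ ((2 : ℤ) ^ k) hS2 n hc)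
    (fun n k ↦ hm₀ z hz n k)
    (fun n k c Q ↦ layerPairingMod_reduceTorsionH1 A κ v n k c Q)
    (fun n k c Q hQ ↦ layerPairingMod_layerCores_lit A κ v hκ hv n k c Q hQ)
    (fun n y hy ↦ ?_)
  -- (I): integrality of `2^e • y` — at bad odd places by `hI`, elsewhere from the admissible reductions
  rw [Kato2004.mem_integralH1_iff]
  intro w hw2 𝔓 h𝔓
  have hw2' : ((2 : ℕ) : 𝓞 ℚ) ∉ w.asIdeal :=
    Rat.natCast_not_mem_asIdeal_of_not_dvd fun hdvd ↦
      hw2 ((Nat.prime_dvd_prime_iff_eq (primesEquiv w).2 Nat.prime_two).mp hdvd)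
  by_cases hbad : w ∈ A.badPlaces (𝓞 ℚ)
  · exact he n y w hbad hw2' 𝔓 h𝔓
  · have hwS : w ∉ ({u : HeightOneSpectrum (𝓞 ℚ) | ((2 : ℕ) : 𝓞 ℚ) ∈ u.asIdeal} ∪ A.badPlaces (𝓞 ℚ)) := by
      rintro (h | h)
      · exact hw2' h
      · exact hbad h
    rw [map_smul, resLe_inertia_eq_zero_of_forall_reduceH1Pk A (κ.layerSubgroup n) _ y (fun k ↦ hy k w hwS 𝔓 h𝔓), smul_zero]

end SignedLowerOffTwo.PTDeep

end Summit.BirchSwinnertonDyer.BirchSwinnertonDyer.Theorems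

end
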